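import Literature.MathematicalPhysics.QuantumFieldTheory.BalabanImbrieJaffe1984to88.BIJ88Eq5128Frame
import Literature.MathematicalPhysics.QuantumFieldTheory.BalabanImbrieJaffe1984to88.BIJ88RT53DensityForm

/-!
# `BalabanImbrieJaffe1984to88.BIJ88FinalForm313` — T. Bałaban, J. Imbrie, A. Jaffe, *Effective action and cluster properties of the
abelian Higgs model*, Commun. Math. Phys. **114** (1988) 257–315 [BalabanImbrieJaffe1988], p. 313 [PDF 57]: *"By inserting (5.14.5), (5.15.1),
(5.15.2) in (5.12.8), we obtain the final form of the density ρ^L_{k+1}(v, ψ)"* and the RESULT display pp. 313–314 *"ρ_{k+1}(v, ψ) = Σ_{{X_{ω′}}}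
∫Π_{j=0}^{k} du^{(j)}|_{Λ^{(j)c*}_{10}} ρ′_{k+1}(v, ψ, {X_{ω′}}, {u^{(j)}}) … which is in the form of our original induction hypothesis, (4.1)"* —
**THE INSERTION AND THE OUTER STRUCTURE OF THE RESULT, AT MEASURE LEVEL, PROVED.**

statement-level skeleton of published theorems with citation tags; proofs where landed; nothing here is a claim about the Yang–Mills mass gap

THE PRINT (p. 313 [PDF 57] – p. 314 [PDF 58]; re-read this session as images `renders/c2-p056.png` … `c2-p058.png` of the seat folder).  After (5.12.8)
(this seat's `BIJ88Eq5128Display.IsDC`: exterior integral × conditional interior integral `∫dμ^{(k)}_{Λ^{(k)}_{10}}(…)`), Sects. 5.13–5.14 compute the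
interior integral by a cluster expansion, with the result (5.14.5) p. 312 *"e^{−V^{(k)}_{const}(Λ^{(k)}_8)} Σ_{{X_α}}Πg_2(X_α) = Σ_{{X_α} overlapping
Λ^{(k)c}_{11}} Πg_2(X_α) Σ_{{X_{r′}}} ΠG_k(X_{r′}) × Π_{c: X_c ⊄ ∪X_{r′}} F^L_{k+1,loc}(X_c) exp(−𝒫^L_{k+1,loc}(Λ^{(k)}_8) − Σ_X W^{(k)}_6(X))"*; Sect. 5.15
Mayer-expands *"exp(−Σ_X W^{(k)}_6(X)) = Σ_{S_6}Π_{X∈S_6}(e^{−W^{(k)}_6(X)} − 1) (5.15.1)"*, defines `Λ^{(k)}_{13}` and splits *"Π_{c: X_c ⊄ ∪X_{r′}}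
F^L_{k+1,loc}(X_c) = Π_{c′}F^L_{k+1,loc}(X_{c′}) Π_{σ′}F^L_{k+1,loc}(X_{σ′}) (5.15.2)"*; then *"By inserting (5.14.5), (5.15.1), (5.15.2) in (5.12.8), we
obtain the final form of the density ρ^L_{k+1}(v, ψ)"*; after the scaling (5.15.3) (r16's `BIJ88RTIterated.scaleStep`, p31's `BIJ88Scaling313Background`):
*"Let {X_{ω′}} be the components of Λ^{(k)c}_{13} … We exhibit the factorization of most of the terms in ρ_{k+1}(v, ψ) by writing ρ_{k+1}(v, ψ) =
Σ_{{X_{ω′}}} ∫Π_{j=0}^{k} du^{(j)}|_{Λ^{(j)c*}_{10}} ρ′_{k+1}(v, ψ, {X_{ω′}}, {u^{(j)}}), ρ′_{k+1}(v, ψ, {X_{ω′}}, {u^{(j)}}) = χ_{k+1,Λ^{(k)′}_0} Π_{ω′}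
g_{k+1}(X_{ω′}) Π_{σ′}F_{k+1,loc}(X_{σ′}) Π_{j=0}^{k}[Z^{(j)}_{Λ^{(j)c*c}_{10}} Z^{(j)}_{Λ^{(j)}_{10}}(u_{k+1})] × exp[−½⟨Λ^{(k)′**}_5 f^{(k+1)}, σ_{k+1,loc}
Λ^{(k)′**}_5 f^{(k+1)}⟩ − ½⟨Λ^{(k)′}_8ψ, Δ_{k+1,loc}(u_{k+1})Λ^{(k)′}_8ψ⟩ − 𝒫_{k+1,loc}(Λ^{(k)}_8) − ℰ_{k+1}], which is in the form of our original
induction hypothesis, (4.1). The hole functional has the expression g_{k+1}(X_{ω′}) = Σ_{S_4, σ̃_1, Λ̃^{(k)}_9∩X_{ω′}, {X_α}, {X_{r′}}, S_6 compatible with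
X_{ω′}} × ∫dφ^{(k)}|_{Λ^{(k)c}_{10}∩X_{ω′}} δ_{Ax, Λ^{(k)′c}_{10}∩X_{ω′}}(u^{(k)}) δ_{Λ^{(k)′*c}_1∩X_{ω′}}(v/Qu^{(k)}) × … (5.15.4). Compatibility means that the
summations run over sets associated only with X_{ω′} and that the sets would have given us X_{ω′} in the course of our constructions."*

WHAT IS TYPED / PROVED HERE (defs with bodies + theorems; 0 `sorry`; no `Prop`-valued fact; standard axioms):
* §1 `IsDF` — THE FINAL FORM at measure level: an exterior-only display `∫dvdψ ρ g = Σ_s ∫dv′∫dψ∫ext_s Y_s · g(v_Λ, ψ)`; (5.12.8) IS such a display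
  with `Y_t = X_t · ∫B_t dμ_t` (`isDC_iff_isDF`, definitional); congruence / normalization / a.e. uniqueness.
* §2 **`isDF_insert` (PROVED)** — *"By inserting …"*: a pointwise finite-sum identity `Y_t = Σ_{π s = t} Y′_s` (jointly integrable pieces) turns the
  display over `terms` into the display over the enlarged family `terms′`; **`isDF_of_isDC_insert`**: from (5.12.8), an identity for the VALUE of the
  interior integral `∫B_t dμ_t = Σ_{π s = t} C_s` (the content of (5.14.5) with (5.15.1), (5.15.2) inserted — rows C2.Eq5.14.5 (p25's
  `BIJ88Result5145.eq5145`), C2.Eq5.15.1-5.15.2 (r16's `eq5112`, `eq5152`), entering BY HYPOTHESIS as the pointwise identity) gives the final form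
  with `Y_s = X_{π s} · C_s`; reading table `Cluster5145` for the inserted factors.
* §3 THE HOLE FAMILIES: `IsR313` — the RESULT's outer sum `Σ_{{X_{ω′}}}` with, for each family, the inner sum over the data *"compatible with X_{ω′}"*
  read as THE FIBRE of the map `s ↦ {X_{ω′}}(s)` (the components of `Λ^{(k)c}_{13}(s)`); **`isR313_of_isDF` (PROVED)**, a regrouping.
* §4 **THE MEASURE OF (4.1) AT LEVEL k+1 (PROVED, hypothesis-free)**: the exterior measure of (5.12.8) over the one-bond laws of `𝒟u δ_{Ax}` IS r18's
  `prevMeasure P (k+1) = Π_{j=0}^{k}𝒟u^{(j)}` times the exterior `φ^{(k)}`-Lebesgue measure, read through the axial gauge fixing `fixBonds` of `u^{(k)}`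
  (the `δ_{Ax}(u^{(k)})` of (5.15.4)) and the freezing of the interior variables: `extMeasure_eq_map_freeze`, **`extMeasure_axial_eq_map_prevSucc`**
  (`Interior.extMeasure (axialLaw) = ((prevMeasure P (k+1)) ⊗ dφ^{(k)}|_{Λ^{(k)c}_{10}}).map cfg41`) — the fine field `u` has become the `k`-th previous
  field `u^{(k)}` (*"∫Π_{j=0}^{k} du^{(j)}|_{Λ^{(j)c*}_{10}}"*: the integrand ignores the interior bonds, *"∫du^{(j)} = 1"* p. 274).
* §6 **`result313_of_isDT` (PROVED)** — THE WHOLE PASSAGE (5.9.6) ⇒ RESULT at measure level in one statement: from gen 9's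
  `IsDT (𝒟u δ_{Ax}) terms Λ Q J ρ^L_{k+1}` through the expansions of Sect. 5.11 (`isDT_expand`), the conditioning of Sect. 5.12 (`isDC_of_isDT`), the
  insertion of (5.14.5)/(5.15.1)/(5.15.2) (`isDF_insert`) and the hole-family regrouping with the (4.1)-measure at `k+1`, every pointwise identity
  entering as a displayed hypothesis.
* §5 **`result313_tested` (PROVED)**: from the final form over the (5.12.8) exterior measures, the RESULT display in TESTED form —
  `∫dvdψ ρ_{k+1} g = Σ_{{X_{ω′}}} Σ_{s compatible} ∫dv′∫dψ ∫_{Π_{j≤k}𝒟u^{(j)} ⊗ dφ^{(k)}|_{Λ^{(k)c}_{10}}} Y_s(cfg41) g(v_Λ(u^{(k)}, v′), ψ)` (`IsR41T`), with the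
  reading table `Result313` for the printed `ρ′_{k+1}` factors.
* §7 (v1.1, seat p34 gen 11; the owner's nicety r16 2026-08-22T03:22:11Z) `IsResult313` — the RESULT display as ONE predicate: `IsR41T` whose
  integrand is the transcribed `rhoPrime313` of the table at each term's hole (`isResult313_iff` definitional, `isResult313_of_isR41T`).
HONEST SCOPE.  The identities (5.14.5), (5.15.1), (5.15.2) enter as the pointwise hypothesis of `isDF_insert` (their rows hold them); the
factorization of the fibre sum into `Π_{ω′} g_{k+1}(X_{ω′})` × global factors (locality of the constructions, *"compatibility"*) is NOT proved — the
RESULT is established as `Σ_{{X_{ω′}}} ∫Π_{j≤k}du^{(j)} [Σ_{compatible} ∫dφ^{(k)}|_{ext} …]` with the bracket transcribed, not factorized; the test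
function stays (the `δ(v/Qu^{(k)})` of (5.15.4) is the push-forward reading `vCut`, no disintegration in `v` is performed — so `ρ_{k+1}` is not
exhibited as r18's FUNCTION `BIJ88InductiveForm41.rho` at `k+1`); the scaling (5.15.3) is not applied here (rows C2.Eq5.15.3, r16/p31); no bound
(p. 314: *"we cannot complete the estimates until after extracting convergence from the large field conditions"*).
Seat p34 gen 10, file 5 (own lineage = the C1/C2 renormalization-transformation line at measure level: (3.11) → (5.1.1) → (5.2.8) → (5.3.6) → (5.9.6) →
(5.12.8) → p. 313).

CITATION HEADER (lean-in-tree rule).  Part of the lit-balaban TYPED SKELETON (HOME `run/shared/lean/pub/lit-balaban/`), PHASE-2 proof seat p34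
gen 10 (unit `lit-balaban-p34-g10`).  Rows served: **`C2.Claim@313`** (toward: insertion sentence + outer structure + (4.1)-measure at k+1, PROVED;
head decided by the owner r16, `HOME/lit-balaban-r16/ROWS-C2-part2.md`), member `C2.Eq5.15.1-5.15.2` (the p. 313 insertion sentence), support
`C2.Eq5.14.5`.  PDF held: `paper:balaban1988-cmp114-bij-abelian-higgs-effective-action` (journal page = PDF page + 256).
Imports this seat's `BIJ88Eq5128Frame` (hence `BIJ88Eq5128Display`) and gen 8's `BIJ88RT53DensityForm` (`measurePreserving_snoc`) (Literature +
Mathlib only).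
-/

namespace Literature.MathematicalPhysics.QuantumFieldTheory.BalabanImbrieJaffe1984to88.BIJ88FinalForm313

open Literature.MathematicalPhysics.QuantumFieldTheory.Balaban1983to89
open BIJ88Sect3Statements (U1)
open BIJ85Sect1Model (HiggsField)
open BIJ88RenormTransf311 (axialMeasure axialBonds)
open BIJ88InductiveForm41 (Prev prevMeasure)
open T4AxialGaugeFixing (fixBonds measurable_fixBonds)
open BIJ88RT51Unique (ae_eq_of_forall_test integral_test_congr_ae)
open BIJ88RT53DensityForm (measurePreserving_snoc)
open BIJ88Eq596Display (vCut vCut_apply)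
open BIJ88Eq5128Split (Cfg UCfg PCfg cfgMeasure prevPi prevMeasure_eq_prevPi Interior)
open BIJ88Eq5128Display (IsDC axialLaw axialMeasure_eq_pi_axialLaw fieldMeasure_eq_pi_haar termIntegrand termMeasure)
open BIJ88Eq5128Display.Weight (normW condW)
open BIJ88Eq5128Frame (isDC_of_isDT_expand isDT_axial_iff)
open BIJ88Eq596Display (uCut IsDT)
open scoped BigOperators ENNReal
open _root_.MeasureTheory _root_.MeasureTheory.Measure Function Set

noncomputable section

variable {P : Params} {k : ℕ}

/-! ## §1 The final form of the density at measure level -/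

section Display

/-- **THE FINAL FORM OF THE DENSITY `ρ^L_{k+1}(v, ψ)` (p. 313) AT MEASURE LEVEL** — an exterior-only display: `ρ̃` is a `(v, ψ)`-density w.r.t.
`dv dψ` such that for every bounded measurable test function `g`,
`∫dv dψ ρ̃ g = Σ_{s∈terms} ∫dv′ ∫dψ ∫ext_s(dq) Y_s(q, v′, ψ) · g(v_{Λ_s}(q, v′), ψ)`.
DATA: the family of terms (after the insertions: `({X_ω}, Λ_0, S_4, σ̃_1, Λ̃_9, S_Y, S_5, {X_α}, {X_{r′}}, S_6, …)`), the cut-offs `Λ_s`, the block average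
`Qu`, the exterior measures `ext_s` (line 1 of (5.12.8)) and the brackets `Y_s` = (lines 2–7 of (5.12.8)) × (the value of the conditional interior
integral, one term of (5.14.5) × (5.15.1) × (5.15.2)). [cite: BalabanImbrieJaffe1988, §5.15 p.313] -/
def IsDF {ι : Type*} (terms : Finset ι) (Λ : ι → Finset (PBond P (k+1))) (Qu : GaugeField P k U1 → GaugeField P (k+1) U1)
    (ext : ι → Measure (Cfg P k)) (Y : ι → Cfg P k → GaugeField P (k+1) U1 → HiggsField P (k+1) → ℂ)
    (ρL : GaugeField P (k+1) U1 → HiggsField P (k+1) → ℂ) : Prop :=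
  ∀ g : GaugeField P (k+1) U1 × HiggsField P (k+1) → ℂ, Measurable g → (∃ C : ℝ, ∀ z, ‖g z‖ ≤ C) →
    ∫ v, ∫ ψ, ρL v ψ * g (v, ψ) ∂volume ∂fieldMeasure P (k+1) U1 =
      ∑ s ∈ terms, ∫ v', ∫ ψ, ∫ q, Y s q v' ψ * g (vCut Qu (Λ s) q.1 v', ψ) ∂ext s ∂volume ∂fieldMeasure P (k+1) U1

variable {ι : Type*} {terms : Finset ι} {Λ : ι → Finset (PBond P (k+1))} {Qu : GaugeField P k U1 → GaugeField P (k+1) U1}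
variable {ext : ι → Measure (Cfg P k)} {Y Y' X B : ι → Cfg P k → GaugeField P (k+1) U1 → HiggsField P (k+1) → ℂ}
variable {cond : ι → Cfg P k → GaugeField P (k+1) U1 → HiggsField P (k+1) → Measure (Cfg P k)}
variable {ρL ρL' : GaugeField P (k+1) U1 → HiggsField P (k+1) → ℂ}

/-- **(5.12.8) is a final-form display** with the bracket `Y_t = X_t · ∫B_t dμ_t` (definitional). [cite: BalabanImbrieJaffe1988, (5.12.8) p.303] -/
theorem isDC_iff_isDF :
    IsDC terms Λ Qu ext X cond B ρL ↔ IsDF terms Λ Qu ext (fun t q v' ψ => X t q v' ψ * ∫ q', B t q' v' ψ ∂cond t q v' ψ) ρL :=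
  Iff.rfl

/-- Rewriting the brackets pointwise does not change the display. [cite: BalabanImbrieJaffe1988, §5.15 p.313] -/
theorem IsDF.congr (h : IsDF terms Λ Qu ext Y ρL) (hY : ∀ s ∈ terms, ∀ q v' ψ, Y' s q v' ψ = Y s q v' ψ) : IsDF terms Λ Qu ext Y' ρL :=
  fun g hg hb => by
  rw [h g hg hb]
  refine Finset.sum_congr rfl fun s hs => ?_
  simp only [hY s hs]

/-- Normalization of the final form (test `g ≡ 1`). [cite: BalabanImbrieJaffe1988, §5.15 p.313] -/
theorem integral_eq_of_isDF (h : IsDF terms Λ Qu ext Y ρL) :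
    ∫ v, ∫ ψ, ρL v ψ ∂volume ∂fieldMeasure P (k+1) U1 = ∑ s ∈ terms, ∫ v', ∫ ψ, ∫ q, Y s q v' ψ ∂ext s ∂volume ∂fieldMeasure P (k+1) U1 := by
  have h1 := h (fun _ => (1 : ℂ)) measurable_const ⟨1, fun _ => by simp⟩
  simp only [mul_one] at h1
  exact h1

/-- **The final form determines the density `dv dψ`-almost everywhere.** [cite: BalabanImbrieJaffe1988, §5.15 p.313] -/
theorem isDF_unique (h : IsDF terms Λ Qu ext Y ρL) (h' : IsDF terms Λ Qu ext Y ρL')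
    (hi : Integrable (uncurry ρL) ((fieldMeasure P (k+1) U1).prod volume))
    (hi' : Integrable (uncurry ρL') ((fieldMeasure P (k+1) U1).prod volume)) :
    uncurry ρL =ᵐ[(fieldMeasure P (k+1) U1).prod volume] uncurry ρL' :=
  ae_eq_of_forall_test hi hi' fun g hg hb => by rw [h g hg hb, h' g hg hb]

/-- A `dv dψ`-integrable function a.e. equal to an integrable solution is a solution. [cite: BalabanImbrieJaffe1988, §5.15 p.313] -/
theorem isDF_congr_ae (h : IsDF terms Λ Qu ext Y ρL) (hi : Integrable (uncurry ρL) ((fieldMeasure P (k+1) U1).prod volume))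
    (hi' : Integrable (uncurry ρL') ((fieldMeasure P (k+1) U1).prod volume))
    (hae : uncurry ρL' =ᵐ[(fieldMeasure P (k+1) U1).prod volume] uncurry ρL) : IsDF terms Λ Qu ext Y ρL' := fun g hg hb => by
  rw [integral_test_congr_ae hi hi' hae hg hb]
  exact h g hg hb

end Display

/-! ## §2 Inserting a pointwise finite-sum identity -/

section Insert

variable {α β γ : Type*} [MeasurableSpace α] [MeasurableSpace β] [MeasurableSpace γ]
variable {μa : Measure α} {μb : Measure β} {μc : Measure γ} [SFinite μa] [SFinite μb] [SFinite μc]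
variable {E : Type*} [NormedAddCommGroup E] [NormedSpace ℝ E]

/-- kernel: three-fold Fubini in the nesting order. [folklore] -/
private theorem integral_prod₃ {K : α × (β × γ) → E} (hK : Integrable K (μa.prod (μb.prod μc))) :
    ∫ r, K r ∂μa.prod (μb.prod μc) = ∫ a, ∫ b, ∫ c, K (a, (b, c)) ∂μc ∂μb ∂μa := by
  rw [integral_prod _ hK]
  refine integral_congr_ae ?_
  filter_upwards [hK.prod_right_ae] with a ha
  rw [integral_prod _ ha]

/-- The measure of the three iterated integrals `dv′, dψ, ext_s` of one term of the final form. [cite: BalabanImbrieJaffe1988, §5.15 p.313] -/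
def termMeasure313 (μ : Measure (Cfg P k)) : Measure (GaugeField P (k+1) U1 × (HiggsField P (k+1) × Cfg P k)) :=
  (fieldMeasure P (k+1) U1).prod ((volume : Measure (HiggsField P (k+1))).prod μ)

/-- kernel (plumbing): the term measure is s-finite. [cite: BalabanImbrieJaffe1988, §5.15 p.313] -/
instance sFinite_termMeasure313 (μ : Measure (Cfg P k)) [SFinite μ] : SFinite (termMeasure313 (P := P) (k := k) μ) := by
  unfold termMeasure313; infer_instance

variable {ι ι' : Type*} {terms : Finset ι} {Λ : ι → Finset (PBond P (k+1))} {Qu : GaugeField P k U1 → GaugeField P (k+1) U1}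
variable {ext : ι → Measure (Cfg P k)} {Y X B : ι → Cfg P k → GaugeField P (k+1) U1 → HiggsField P (k+1) → ℂ}
variable {cond : ι → Cfg P k → GaugeField P (k+1) U1 → HiggsField P (k+1) → Measure (Cfg P k)}
variable {ρL : GaugeField P (k+1) U1 → HiggsField P (k+1) → ℂ}

/-- kernel: the test function read through the block field is jointly measurable in `(v′, ψ, q)`. [cite: BalabanImbrieJaffe1988, §5.15 p.313] -/
theorem measurable_test313 (hQu : Measurable Qu) (Λ₀ : Finset (PBond P (k+1))) {g : GaugeField P (k+1) U1 × HiggsField P (k+1) → ℂ}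
    (hg : Measurable g) :
    Measurable fun r : GaugeField P (k+1) U1 × (HiggsField P (k+1) × Cfg P k) => g (vCut Qu Λ₀ r.2.2.1 r.1, r.2.1) := by
  refine hg.comp (Measurable.prodMk ?_ measurable_snd.fst)
  refine measurable_pi_iff.mpr fun c => ?_
  by_cases hc : c ∈ Λ₀
  · simp only [vCut_apply, if_pos hc]; exact (measurable_pi_apply c).comp measurable_fst
  · simp only [vCut_apply, if_neg hc]; exact (measurable_pi_apply c).comp (hQu.comp (measurable_fst.comp measurable_snd.snd))

/-- kernel: a term's three iterated integrals of an integrable tested bracket are its integral against the term measure.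
[cite: BalabanImbrieJaffe1988, §5.15 p.313] -/
theorem iter₃_eq_integral_termMeasure313 {μ : Measure (Cfg P k)} [SFinite μ] {Ys : Cfg P k → GaugeField P (k+1) U1 → HiggsField P (k+1) → ℂ}
    {Λ₀ : Finset (PBond P (k+1))} {g : GaugeField P (k+1) U1 × HiggsField P (k+1) → ℂ}
    (hK : Integrable (fun r : GaugeField P (k+1) U1 × (HiggsField P (k+1) × Cfg P k) =>
      Ys r.2.2 r.1 r.2.1 * g (vCut Qu Λ₀ r.2.2.1 r.1, r.2.1)) (termMeasure313 μ)) :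
    ∫ v', ∫ ψ, ∫ q, Ys q v' ψ * g (vCut Qu Λ₀ q.1 v', ψ) ∂μ ∂volume ∂fieldMeasure P (k+1) U1 =
      ∫ r, Ys r.2.2 r.1 r.2.1 * g (vCut Qu Λ₀ r.2.2.1 r.1, r.2.1) ∂termMeasure313 μ := by
  unfold termMeasure313 at hK ⊢
  rw [integral_prod₃ hK]

/-- **"BY INSERTING (5.14.5), (5.15.1), (5.15.2) IN (5.12.8), WE OBTAIN THE FINAL FORM OF THE DENSITY" — THE INSERTION OF A POINTWISE FINITE-SUM
IDENTITY, PROVED.**  If every bracket `Y_t` of a final-form display over `terms` is pointwise the finite sum `Σ_{s : π s = t} Y′_s` of new brackets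
indexed by `terms′` (parent map `π`), each jointly integrable in `(v′, ψ, q)` against `dv′ ⊗ dψ ⊗ ext_{π s}`, then the same density satisfies the
final-form display over `terms′` with the parents' cut-offs and exterior measures. [cite: BalabanImbrieJaffe1988, §5.15 p.313] -/
theorem isDF_insert [∀ t, SFinite (ext t)] [DecidableEq ι] (h : IsDF terms Λ Qu ext Y ρL) (terms' : Finset ι') (π : ι' → ι)
    (hπ : ∀ s ∈ terms', π s ∈ terms) (Y' : ι' → Cfg P k → GaugeField P (k+1) U1 → HiggsField P (k+1) → ℂ)
    (hY : ∀ t ∈ terms, ∀ q v' ψ, Y t q v' ψ = ∑ s ∈ terms'.filter (fun s => π s = t), Y' s q v' ψ) (hQu : Measurable Qu)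
    (hY'i : ∀ s ∈ terms', Integrable (fun r : GaugeField P (k+1) U1 × (HiggsField P (k+1) × Cfg P k) => Y' s r.2.2 r.1 r.2.1)
      (termMeasure313 (ext (π s)))) :
    IsDF terms' (Λ ∘ π) Qu (ext ∘ π) Y' ρL := by
  intro g hg hb
  obtain ⟨C, hC⟩ := hb
  rw [h g hg ⟨C, hC⟩]
  -- each new term, tested, is integrable against its parent's term measure
  have hI : ∀ s ∈ terms', Integrable (fun r : GaugeField P (k+1) U1 × (HiggsField P (k+1) × Cfg P k) =>
      Y' s r.2.2 r.1 r.2.1 * g (vCut Qu (Λ (π s)) r.2.2.1 r.1, r.2.1)) (termMeasure313 (ext (π s))) :=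
    fun s hs => (hY'i s hs).mul_bdd (measurable_test313 hQu (Λ (π s)) hg).aestronglyMeasurable (Filter.Eventually.of_forall fun r => hC _)
  -- regroup the new terms by parent
  rw [← Finset.sum_fiberwise_of_maps_to (g := π) (fun s hs => hπ s hs)]
  refine Finset.sum_congr rfl fun t ht => ?_
  have hI' : ∀ s ∈ terms'.filter (fun s => π s = t), Integrable (fun r : GaugeField P (k+1) U1 × (HiggsField P (k+1) × Cfg P k) =>
      Y' s r.2.2 r.1 r.2.1 * g (vCut Qu (Λ t) r.2.2.1 r.1, r.2.1)) (termMeasure313 (ext t)) := by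
    intro s hs
    obtain ⟨hs', hst⟩ := Finset.mem_filter.mp hs
    subst hst
    exact hI s hs'
  -- the parent's term: its bracket is the sum of the children's brackets
  have hK : Integrable (fun r : GaugeField P (k+1) U1 × (HiggsField P (k+1) × Cfg P k) =>
      Y t r.2.2 r.1 r.2.1 * g (vCut Qu (Λ t) r.2.2.1 r.1, r.2.1)) (termMeasure313 (ext t)) := by
    refine (integrable_finsetSum _ hI').congr (Filter.Eventually.of_forall fun r => ?_)
    simp only
    rw [hY t ht, Finset.sum_mul]
  have e1 : ∫ v', ∫ ψ, ∫ q, Y t q v' ψ * g (vCut Qu (Λ t) q.1 v', ψ) ∂ext t ∂volume ∂fieldMeasure P (k+1) U1 =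
      ∫ r, (∑ s ∈ terms'.filter (fun s => π s = t), Y' s r.2.2 r.1 r.2.1 * g (vCut Qu (Λ t) r.2.2.1 r.1, r.2.1)) ∂termMeasure313 (ext t) := by
    rw [iter₃_eq_integral_termMeasure313 hK]
    refine integral_congr_ae (Filter.Eventually.of_forall fun r => ?_)
    simp only
    rw [hY t ht, Finset.sum_mul]
  refine e1.trans ?_
  rw [integral_finsetSum _ hI']
  refine Finset.sum_congr rfl fun s hs => ?_
  obtain ⟨hs', hst⟩ := Finset.mem_filter.mp hs
  subst hst
  simp only [Function.comp_apply]
  exact (iter₃_eq_integral_termMeasure313 (hI s hs')).symm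

/-- **THE INSERTED FACTORS, AS TYPED SLOTS** — the right side of (5.14.5) with (5.15.1), (5.15.2) inserted: one term of
`Σ_{{X_α}}Σ_{{X_{r′}}}Σ_{S_6} Πg_2(X_α) ΠG_k(X_{r′}) Π_{X∈S_6}(e^{−W^{(k)}_6(X)} − 1) Π_{c′}F^L_{k+1,loc}(X_{c′}) Π_{σ′}F^L_{k+1,loc}(X_{σ′}) e^{−𝒫^L_{k+1,loc}(Λ^{(k)}_8)}`,
as functions of the term and of the configuration, `v′`, `ψ` (the constructions are rows C2.Eq5.13.x–5.15.2 and are NOT repeated here).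
[cite: BalabanImbrieJaffe1988, (5.14.5) p.312] -/
structure Cluster5145 (P : Params) (k : ℕ) (ι' : Type*) where
  /-- `Π_α g_2(X_α)`, `{X_α}` overlapping `Λ^{(k)c}_{11}` ((5.13.4), p. 306). -/
  g2 : ι' → Cfg P k → GaugeField P (k+1) U1 → HiggsField P (k+1) → ℂ
  /-- `Π_{r′} G_k(X_{r′})` — the remainder activities of p. 312. -/
  Gk : ι' → Cfg P k → GaugeField P (k+1) U1 → HiggsField P (k+1) → ℂ
  /-- `Π_{X∈S_6} (e^{−W^{(k)}_6(X)} − 1)` — the Mayer factors of (5.15.1). -/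
  mayer6 : ι' → Cfg P k → GaugeField P (k+1) U1 → HiggsField P (k+1) → ℝ
  /-- `Π_{c′} F^L_{k+1,loc}(X_{c′})` — the next-step observables inside the holes ((5.15.2), `{c′}` "the rest"). -/
  obsHole : ι' → Cfg P k → GaugeField P (k+1) U1 → HiggsField P (k+1) → ℂ
  /-- `Π_{σ′} F^L_{k+1,loc}(X_{σ′})` — the next-step observables in `Λ^{(k)}_{13}` ((5.15.2)). -/
  obsNext : ι' → Cfg P k → GaugeField P (k+1) U1 → HiggsField P (k+1) → ℂ
  /-- `𝒫^L_{k+1,loc}(Λ^{(k)}_8)` — the next-step interaction ((5.14.2), p. 311). -/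
  PL : ι' → Cfg P k → GaugeField P (k+1) U1 → HiggsField P (k+1) → ℝ

/-- **The inserted value of the interior integral, transcribed**: `Πg_2 · ΠG_k · Π(e^{−W_6}−1) · Π_{c′}F^L · Π_{σ′}F^L · e^{−𝒫^L_{k+1,loc}}`.
[cite: BalabanImbrieJaffe1988, (5.14.5) p.312] -/
def clusterValue5145 {ι' : Type*} (DC : Cluster5145 P k ι') (s : ι') (q : Cfg P k) (v' : GaugeField P (k+1) U1) (ψ : HiggsField P (k+1)) : ℂ :=
  DC.g2 s q v' ψ * DC.Gk s q v' ψ * (DC.mayer6 s q v' ψ : ℂ) * DC.obsHole s q v' ψ * DC.obsNext s q v' ψ * (Real.exp (-DC.PL s q v' ψ) : ℂ)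

/-- **FROM (5.12.8): INSERTING THE CLUSTER EXPANSION OF THE INTERIOR INTEGRAL.**  If, term by term and pointwise in the exterior variables, the
conditional interior integral of (5.12.8) equals a finite sum of new factors, `∫B_t dμ_t[q, v′, ψ] = Σ_{s : π s = t} C_s(q, v′, ψ)` — the content of
(5.14.5) with (5.15.1), (5.15.2) inserted, summed over `({X_α}, {X_{r′}}, S_6, …)` — and each `X_{π s} · C_s` is jointly integrable, then the density
satisfies THE FINAL FORM over the enlarged family with brackets `Y_s = X_{π s} · C_s`. [cite: BalabanImbrieJaffe1988, §5.15 p.313] -/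
theorem isDF_of_isDC_insert [∀ t, SFinite (ext t)] [DecidableEq ι] (h : IsDC terms Λ Qu ext X cond B ρL) (terms' : Finset ι')
    (π : ι' → ι) (hπ : ∀ s ∈ terms', π s ∈ terms) (C : ι' → Cfg P k → GaugeField P (k+1) U1 → HiggsField P (k+1) → ℂ)
    (hC : ∀ t ∈ terms, ∀ q v' ψ, ∫ q', B t q' v' ψ ∂cond t q v' ψ = ∑ s ∈ terms'.filter (fun s => π s = t), C s q v' ψ)
    (hQu : Measurable Qu)
    (hi : ∀ s ∈ terms', Integrable (fun r : GaugeField P (k+1) U1 × (HiggsField P (k+1) × Cfg P k) =>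
      X (π s) r.2.2 r.1 r.2.1 * C s r.2.2 r.1 r.2.1) (termMeasure313 (ext (π s)))) :
    IsDF terms' (Λ ∘ π) Qu (ext ∘ π) (fun s q v' ψ => X (π s) q v' ψ * C s q v' ψ) ρL := by
  refine isDF_insert (isDC_iff_isDF.mp h) terms' π hπ _ (fun t ht q v' ψ => ?_) hQu hi
  rw [hC t ht q v' ψ, Finset.mul_sum]
  refine Finset.sum_congr rfl fun s hs => ?_
  rw [(Finset.mem_filter.mp hs).2]

/-- The same with the transcribed inserted factors `C_s = clusterValue5145 DC s`. [cite: BalabanImbrieJaffe1988, (5.14.5) p.312] -/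
theorem isDF_of_isDC_insert5145 [∀ t, SFinite (ext t)] [DecidableEq ι] (DC : Cluster5145 P k ι') (h : IsDC terms Λ Qu ext X cond B ρL)
    (terms' : Finset ι') (π : ι' → ι) (hπ : ∀ s ∈ terms', π s ∈ terms)
    (hC : ∀ t ∈ terms, ∀ q v' ψ, ∫ q', B t q' v' ψ ∂cond t q v' ψ = ∑ s ∈ terms'.filter (fun s => π s = t), clusterValue5145 DC s q v' ψ)
    (hQu : Measurable Qu)
    (hi : ∀ s ∈ terms', Integrable (fun r : GaugeField P (k+1) U1 × (HiggsField P (k+1) × Cfg P k) =>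
      X (π s) r.2.2 r.1 r.2.1 * clusterValue5145 DC s r.2.2 r.1 r.2.1) (termMeasure313 (ext (π s)))) :
    IsDF terms' (Λ ∘ π) Qu (ext ∘ π) (fun s q v' ψ => X (π s) q v' ψ * clusterValue5145 DC s q v' ψ) ρL :=
  isDF_of_isDC_insert h terms' π hπ (clusterValue5145 DC) hC hQu hi

end Insert

/-! ## §3 The hole families: the outer sum of the RESULT -/

section Holes

variable {ι Ω : Type*} {terms : Finset ι} {Λ : ι → Finset (PBond P (k+1))} {Qu : GaugeField P k U1 → GaugeField P (k+1) U1}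
variable {ext : ι → Measure (Cfg P k)} {Y : ι → Cfg P k → GaugeField P (k+1) U1 → HiggsField P (k+1) → ℂ}
variable {ρL : GaugeField P (k+1) U1 → HiggsField P (k+1) → ℂ}

/-- **THE RESULT'S OUTER STRUCTURE `Σ_{{X_{ω′}}} (Σ_{compatible with {X_{ω′}}} …)` AT MEASURE LEVEL**: a final-form display whose terms are grouped by
HOLE FAMILY — for every bounded measurable test `g`, `∫dvdψ ρ̃ g = Σ_{ω ∈ holes} Σ_{s ∈ fam ω} ∫dv′∫dψ∫ext_s Y_s · g(v_{Λ_s}, ψ)`; *"Compatibility means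
that the summations run over sets associated only with X_{ω′} and that the sets would have given us X_{ω′} in the course of our constructions"* —
`fam ω` = the data whose family of components of `Λ^{(k)c}_{13}` is `ω`. [cite: BalabanImbrieJaffe1988, (5.15.4) p.314] -/
def IsR313 (holes : Finset Ω) (fam : Ω → Finset ι) (Λ : ι → Finset (PBond P (k+1))) (Qu : GaugeField P k U1 → GaugeField P (k+1) U1)
    (ext : ι → Measure (Cfg P k)) (Y : ι → Cfg P k → GaugeField P (k+1) U1 → HiggsField P (k+1) → ℂ)
    (ρL : GaugeField P (k+1) U1 → HiggsField P (k+1) → ℂ) : Prop :=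
  ∀ g : GaugeField P (k+1) U1 × HiggsField P (k+1) → ℂ, Measurable g → (∃ C : ℝ, ∀ z, ‖g z‖ ≤ C) →
    ∫ v, ∫ ψ, ρL v ψ * g (v, ψ) ∂volume ∂fieldMeasure P (k+1) U1 =
      ∑ ω ∈ holes, ∑ s ∈ fam ω, ∫ v', ∫ ψ, ∫ q, Y s q v' ψ * g (vCut Qu (Λ s) q.1 v', ψ) ∂ext s ∂volume ∂fieldMeasure P (k+1) U1

/-- **Regrouping the final form by hole family (PROVED)**: with `hole s` = the family `{X_{ω′}}` of a term (`holes` containing all of them), the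
final form is the RESULT's double sum with `fam ω` = the fibre `{s : hole s = ω}`. [cite: BalabanImbrieJaffe1988, (5.15.4) p.314] -/
theorem isR313_of_isDF [DecidableEq Ω] (h : IsDF terms Λ Qu ext Y ρL) (hole : ι → Ω) (holes : Finset Ω)
    (hh : ∀ s ∈ terms, hole s ∈ holes) :
    IsR313 holes (fun ω => terms.filter fun s => hole s = ω) Λ Qu ext Y ρL := fun g hg hb => by
  rw [h g hg hb]
  exact (Finset.sum_fiberwise_of_maps_to hh _).symm

/-- Conversely a hole-grouped display with disjoint families is a final-form display over their union. [cite: BalabanImbrieJaffe1988, (5.15.4) p.314] -/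
theorem isDF_of_isR313 [DecidableEq ι] {holes : Finset Ω} {fam : Ω → Finset ι} (h : IsR313 holes fam Λ Qu ext Y ρL)
    (hd : ∀ ω ∈ holes, ∀ ω' ∈ holes, ω ≠ ω' → Disjoint (fam ω) (fam ω')) :
    IsDF (holes.biUnion fam) Λ Qu ext Y ρL := fun g hg hb => by
  rw [h g hg hb, Finset.sum_biUnion hd]

end Holes

/-! ## §4 The measure of (4.1) at level `k + 1` -/

section Form41

variable (D : Interior P k)

/-- Extension by `0` of the exterior site variables to a Higgs configuration (interior sites frozen). [cite: BalabanImbrieJaffe1988, (5.12.8) p.303] -/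
def extendX (x : D.EX) : HiggsField P k := fun y => if h : y ∈ D.Ix then 0 else x ⟨y, h⟩

/-- kernel: the exterior part of the extension is the given exterior site configuration. [cite: BalabanImbrieJaffe1988, (5.12.8) p.303] -/
theorem splitX_extendX_fst (x : D.EX) : (D.splitX (extendX D x)).1 = x := by
  funext y
  rw [Interior.splitX_fst]
  simp only [extendX, dif_neg y.2]

/-- kernel: the extension is measurable. [cite: BalabanImbrieJaffe1988, (5.12.8) p.303] -/
theorem measurable_extendX : Measurable (extendX D) := by
  refine measurable_pi_iff.mpr fun y => ?_
  by_cases hy : y ∈ D.Ix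
  · simp only [extendX, dif_pos hy]; exact measurable_const
  · simp only [extendX, dif_neg hy]; exact measurable_pi_apply _

/-- **Reading `(u^{(k)}, {u^{(j)}}_{j<k}, φ^{(k)}|_{ext})` as a frozen configuration**: `(u, {u^{(j)}}, x) ↦ freeze (u, {u^{(j)}}, extendX x)` — the
integrand of (4.1) at `k+1` ignores the interior bonds. [cite: BalabanImbrieJaffe1988, §5.15 p.313] -/
def freezeExt (r : UCfg P k × (PCfg P k × D.EX)) : Cfg P k := D.freeze (r.1, (r.2.1, extendX D r.2.2))

/-- kernel: `freezeExt` is measurable. [cite: BalabanImbrieJaffe1988, §5.15 p.313] -/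
theorem measurable_freezeExt : Measurable (freezeExt D) :=
  D.measurable_freeze.comp (measurable_fst.prodMk (measurable_snd.fst.prodMk ((measurable_extendX D).comp measurable_snd.snd)))

/-- kernel: `freezeExt` through the exterior coordinates. [cite: BalabanImbrieJaffe1988, §5.15 p.313] -/
theorem freezeExt_eq_glue (r : UCfg P k × (PCfg P k × D.EX)) :
    freezeExt D r = D.glue ((D.splitU r.1).1, ((D.splitP r.2.1).1, r.2.2)) D.base := by
  rw [freezeExt, Interior.freeze_eq_glue, Interior.split_apply, splitX_extendX_fst]

/-- The exterior-coordinate projection `(u, {u^{(j)}}, x) ↦ (u|_{ext}, {u^{(j)}|_{ext}}, x)`. [cite: BalabanImbrieJaffe1988, §5.15 p.313] -/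
def projExt (r : UCfg P k × (PCfg P k × D.EX)) : D.Ext := ((D.splitU r.1).1, ((D.splitP r.2.1).1, r.2.2))

/-- kernel: the projection is measurable. [cite: BalabanImbrieJaffe1988, §5.15 p.313] -/
theorem measurable_projExt : Measurable (projExt D) :=
  (measurable_fst.comp ((D.splitU).measurable.comp measurable_fst)).prodMk
    ((measurable_fst.comp ((D.splitP).measurable.comp measurable_snd.fst)).prodMk measurable_snd.snd)

variable (m : PBond P k → Measure U1) [∀ b, IsProbabilityMeasure (m b)]

/-- kernel (plumbing): the exterior measure of (5.12.8) is s-finite. [cite: BalabanImbrieJaffe1988, (5.12.8) p.303] -/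
instance sFinite_extMeasure : SFinite (D.extMeasure m) := by
  unfold Interior.extMeasure; infer_instance

/-- **Integrating out the interior bond variables**: the push-forward of `Π_b m_b ⊗ Π_{j<k}𝒟u^{(j)} ⊗ dφ^{(k)}|_{ext}` under the exterior projection
is the exterior measure `μExt` (the interior one-bond laws have mass one, *"∫du^{(j)} = 1"* p. 274). [cite: BalabanImbrieJaffe1988, (4.1) p.274] -/
theorem map_projExt :
    ((Measure.pi m).prod ((prevPi P k).prod (volume : Measure D.EX))).map (projExt D) = D.μExt m := by
  have hmU : Measurable fun u : UCfg P k => (D.splitU u).1 := measurable_fst.comp (D.splitU).measurable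
  have hmP : Measurable fun p : PCfg P k => (D.splitP p).1 := measurable_fst.comp (D.splitP).measurable
  have hU : (Measure.pi m).map (fun u => (D.splitU u).1) = D.μEU m := by
    rw [show (fun u => (D.splitU u).1) = Prod.fst ∘ (D.splitU : UCfg P k → D.EU × D.IU) from rfl,
      ← Measure.map_map measurable_fst (D.splitU).measurable, (D.measurePreserving_splitU m).map_eq, Measure.map_fst_prod,
      measure_univ, one_smul]
  have hP : (prevPi P k).map (fun p => (D.splitP p).1) = D.μEP := by
    rw [show (fun p => (D.splitP p).1) = Prod.fst ∘ (D.splitP : PCfg P k → D.EP × D.IP) from rfl,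
      ← Measure.map_map measurable_fst (D.splitP).measurable, (D.measurePreserving_splitP).map_eq, Measure.map_fst_prod,
      measure_univ, one_smul]
  have hPX : ((prevPi P k).prod (volume : Measure D.EX)).map (Prod.map (fun p => (D.splitP p).1) (id : D.EX → D.EX)) =
      D.μEP.prod (volume : Measure D.EX) := by
    rw [← Measure.map_prod_map _ _ hmP measurable_id, hP, Measure.map_id]
  have h3 : ((Measure.pi m).prod ((prevPi P k).prod (volume : Measure D.EX))).map
      (Prod.map (fun u => (D.splitU u).1) (Prod.map (fun p => (D.splitP p).1) (id : D.EX → D.EX))) = D.μExt m := by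
    rw [← Measure.map_prod_map _ _ hmU (hmP.prodMap measurable_id), hU, hPX]
    rfl
  have hproj : projExt D = Prod.map (fun u => (D.splitU u).1) (Prod.map (fun p => (D.splitP p).1) (id : D.EX → D.EX)) := by
    funext r; rfl
  rw [hproj]
  exact h3

/-- **THE EXTERIOR MEASURE OF (5.12.8) FROM THE FULL PRODUCT MEASURE**: `ext = (Π_b m_b ⊗ Π_{j<k}𝒟u^{(j)} ⊗ dφ^{(k)}|_{Λ^{(k)c}_{10}}).map freezeExt` —
integrating the interior bond variables trivially and freezing them in the integrand is the same thing. [cite: BalabanImbrieJaffe1988, §5.15 p.313] -/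
theorem extMeasure_eq_map_freezeExt :
    D.extMeasure m = ((Measure.pi m).prod ((prevPi P k).prod (volume : Measure D.EX))).map (freezeExt D) := by
  have hcomp : freezeExt D = (fun e => D.glue e D.base) ∘ projExt D := by
    funext r; exact freezeExt_eq_glue D r
  rw [hcomp, ← Measure.map_map (D.measurableEmbedding_glue_base).measurable (measurable_projExt D), map_projExt]
  rfl

/-- **`∫_{ext} F = ∫Π_b m_b(du) ∫Π𝒟u^{(j)} ∫dφ^{(k)}|_{ext} F(freeze(u, {u^{(j)}}, φ))`** for an integrable `F` (iterated form).
[cite: BalabanImbrieJaffe1988, §5.15 p.313] -/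
theorem integral_extMeasure_eq_iter {E : Type*} [NormedAddCommGroup E] [NormedSpace ℝ E] {F : Cfg P k → E}
    (hF : Integrable F (D.extMeasure m)) :
    ∫ q, F q ∂D.extMeasure m =
      ∫ u, ∫ prev, ∫ x, F (freezeExt D (u, (prev, x))) ∂volume ∂prevPi P k ∂Measure.pi m := by
  rw [extMeasure_eq_map_freezeExt D m] at hF ⊢
  rw [integral_map (measurable_freezeExt D).aemeasurable hF.aestronglyMeasurable]
  have hF' : Integrable (fun r => F (freezeExt D r)) ((Measure.pi m).prod ((prevPi P k).prod (volume : Measure D.EX))) :=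
    (integrable_map_measure hF.aestronglyMeasurable (measurable_freezeExt D).aemeasurable).mp hF
  exact integral_prod₃ hF'

/-- **THE (4.1)-COORDINATES AT LEVEL k+1**: `({u^{(j)}}_{j≤k}, φ^{(k)}|_{ext}) ↦` the frozen configuration with `u^{(k)}` AXIAL-GAUGE-FIXED
(`fixBonds axialBonds`, the `δ_{Ax}(u^{(k)})` of (5.15.4)) — the fine field has become the `k`-th previous field (`Fin.last`), `{u^{(j)}}_{j<k} = Fin.init`.
[cite: BalabanImbrieJaffe1988, (5.15.4) p.314] -/
def cfg41 (r : Prev P (k+1) × D.EX) : Cfg P k :=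
  freezeExt D (fixBonds (axialBonds : Finset (PBond P k)) (r.1 (Fin.last k)), (Fin.init r.1, r.2))

/-- kernel: the (4.1)-coordinates are measurable. [cite: BalabanImbrieJaffe1988, (5.15.4) p.314] -/
theorem measurable_cfg41 : Measurable (cfg41 D) := by
  refine (measurable_freezeExt D).comp ?_
  refine (((measurable_fixBonds _).comp ((measurable_pi_apply (Fin.last k)).comp measurable_fst)).prodMk
    ((measurable_pi_iff.mpr fun j => ?_).prodMk measurable_snd))
  exact (measurable_pi_apply (Fin.castSucc j)).comp measurable_fst

/-- kernel: `((u, {u^{(j)}}), x) ↦ (Fin.snoc {u^{(j)}} u, x)` carries `(𝒟u ⊗ Π_{j<k}𝒟u^{(j)}) ⊗ dφ|_{ext}` to `Π_{j≤k}𝒟u^{(j)} ⊗ dφ|_{ext}` (gen 8's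
`measurePreserving_snoc`). [cite: BalabanImbrieJaffe1988, (4.1) p.274] -/
theorem measurePreserving_snoc_prod :
    MeasurePreserving (fun r : (GaugeField P k U1 × Prev P k) × D.EX => ((Fin.snoc r.1.2 r.1.1 : Prev P (k+1)), r.2))
      (((fieldMeasure P k U1).prod (prevMeasure P k)).prod (volume : Measure D.EX)) ((prevMeasure P (k+1)).prod (volume : Measure D.EX)) :=
  (measurePreserving_snoc (P := P) (k := k)).prod (MeasurePreserving.id _)

/-- kernel: `((u, {u^{(j)}}), x) ↦ (u[Ax := 1], ({u^{(j)}}, x))` — the axial gauge fixing of the fine field, regrouped (on r18's carriers).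
[cite: BalabanImbrieJaffe1988, (5.15.4) p.314] -/
def axT (r : (GaugeField P k U1 × Prev P k) × D.EX) : GaugeField P k U1 × (Prev P k × D.EX) :=
  (fixBonds (axialBonds : Finset (PBond P k)) r.1.1, (r.1.2, r.2))

/-- kernel: `axT` is measurable. [cite: BalabanImbrieJaffe1988, (5.15.4) p.314] -/
theorem measurable_axT : Measurable (axT D) :=
  ((measurable_fixBonds _).comp (measurable_fst.comp measurable_fst)).prodMk
    ((measurable_snd.comp measurable_fst).prodMk measurable_snd)

/-- kernel: `axT` carries `(𝒟u ⊗ Π_{j<k}𝒟u^{(j)}) ⊗ dφ|_{ext}` to `𝒟u δ_{Ax} ⊗ (Π_{j<k}𝒟u^{(j)} ⊗ dφ|_{ext})` (`𝒟u δ_{Ax} = 𝒟u.map fixBonds`,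
r18's definition of `axialMeasure`). [cite: BalabanImbrieJaffe1988, (3.11) p.266] -/
theorem measurePreserving_axT :
    MeasurePreserving (axT D) (((fieldMeasure P k U1).prod (prevMeasure P k)).prod (volume : Measure D.EX))
      ((axialMeasure P k U1).prod ((prevMeasure P k).prod (volume : Measure D.EX))) := by
  classical
  have h1 : MeasurePreserving (fixBonds (axialBonds : Finset (PBond P k)) : GaugeField P k U1 → GaugeField P k U1)
      (fieldMeasure P k U1) (axialMeasure P k U1) := ⟨measurable_fixBonds _, rfl⟩
  have h := (measurePreserving_prodAssoc (axialMeasure P k U1) (prevMeasure P k) (volume : Measure D.EX)).comp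
    ((h1.prod (MeasurePreserving.id (prevMeasure P k))).prod (MeasurePreserving.id (volume : Measure D.EX)))
  have hf : ((⇑(MeasurableEquiv.prodAssoc : (GaugeField P k U1 × Prev P k) × D.EX ≃ᵐ GaugeField P k U1 × (Prev P k × D.EX))) ∘
      (Prod.map (Prod.map (fixBonds (axialBonds : Finset (PBond P k)) : GaugeField P k U1 → GaugeField P k U1)
        (id : Prev P k → Prev P k)) (id : D.EX → D.EX))) = axT D := by
    funext r; rfl
  rw [hf] at h
  exact h

/-- kernel: the (4.1)-coordinates through `Fin.snoc` are the frozen axial-gauge-fixed configuration. [cite: BalabanImbrieJaffe1988, (5.15.4) p.314] -/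
theorem cfg41_snoc (r : (GaugeField P k U1 × Prev P k) × D.EX) :
    cfg41 D ((Fin.snoc r.1.2 r.1.1 : Prev P (k+1)), r.2) = freezeExt D (fixBonds (axialBonds : Finset (PBond P k)) r.1.1, (r.1.2, r.2)) := by
  simp only [cfg41, Fin.snoc_last, Fin.init_snoc]

/-- kernel: `𝒟u δ_{Ax} ⊗ Π_{j<k}𝒟u^{(j)} ⊗ dφ|_{ext}` on r18's carriers is `Π_b axialLaw_b ⊗ Π_{j<k}𝒟u^{(j)} ⊗ dφ|_{ext}` on the product carriers
(`axialMeasure_eq_pi_axialLaw`, `prevMeasure_eq_prevPi`). [cite: BalabanImbrieJaffe1988, (3.11) p.266] -/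
theorem axial_prod_eq :
    ((axialMeasure P k U1).prod ((prevMeasure P k).prod (volume : Measure D.EX)) : Measure (UCfg P k × (PCfg P k × D.EX))) =
      (Measure.pi (axialLaw P k)).prod ((prevPi P k).prod (volume : Measure D.EX)) := by
  rw [← axialMeasure_eq_pi_axialLaw]
  rfl

/-- **THE EXTERIOR MEASURE OF (5.12.8) IS THE MEASURE OF (4.1) AT LEVEL k+1 (PROVED, hypothesis-free)**: over the one-bond laws of `𝒟u δ_{Ax}`,
`Π_{j≤k} du^{(j)}|_{Λ^{(j)c*}_{10}} dφ^{(k)}|_{Λ^{(k)c}_{10}} δ_{Ax}(u^{(k)})` (line 1 of (5.12.8), this seat's `Interior.extMeasure (axialLaw)`) is the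
push-forward of r18's `prevMeasure P (k+1) = Π_{j=0}^{k}𝒟u^{(j)}` (*"the normalized measure on U(1), ∫du^{(j)} = 1"*) times the exterior
`φ^{(k)}`-Lebesgue measure under the (4.1)-coordinates `cfg41` — the RESULT's *"∫Π_{j=0}^{k} du^{(j)}|_{Λ^{(j)c*}_{10}}"* with `δ_{Ax}(u^{(k)})` inside.
[cite: BalabanImbrieJaffe1988, §5.15 p.313] -/
theorem extMeasure_axial_eq_map_prevSucc :
    D.extMeasure (axialLaw P k) = ((prevMeasure P (k+1)).prod (volume : Measure D.EX)).map (cfg41 D) := by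
  have hS := measurePreserving_snoc_prod D
  have hT := measurePreserving_axT D
  have e1 : ((prevMeasure P (k+1)).prod (volume : Measure D.EX)).map (cfg41 D) =
      (((fieldMeasure P k U1).prod (prevMeasure P k)).prod (volume : Measure D.EX)).map
        (cfg41 D ∘ fun r : (GaugeField P k U1 × Prev P k) × D.EX => ((Fin.snoc r.1.2 r.1.1 : Prev P (k+1)), r.2)) := by
    rw [← hS.map_eq, Measure.map_map (measurable_cfg41 D) hS.measurable]
  have e2 : (cfg41 D ∘ fun r : (GaugeField P k U1 × Prev P k) × D.EX => ((Fin.snoc r.1.2 r.1.1 : Prev P (k+1)), r.2)) =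
      fun r : (GaugeField P k U1 × Prev P k) × D.EX => freezeExt D (axT D r) :=
    funext fun r => cfg41_snoc D r
  have e3 : (((fieldMeasure P k U1).prod (prevMeasure P k)).prod (volume : Measure D.EX)).map
      (fun r : (GaugeField P k U1 × Prev P k) × D.EX => freezeExt D (axT D r)) =
      ((((fieldMeasure P k U1).prod (prevMeasure P k)).prod (volume : Measure D.EX)).map (axT D)).map (freezeExt D) :=
    (Measure.map_map (measurable_freezeExt D) (measurable_axT D)).symm
  rw [e1, e2, e3, hT.map_eq]
  exact (extMeasure_eq_map_freezeExt D _).trans (congrArg (Measure.map (freezeExt D)) (axial_prod_eq D)).symm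

/-- **`∫_{ext(axial)} F = ∫_{Π_{j≤k}𝒟u^{(j)} ⊗ dφ|_{ext}} F ∘ cfg41`** for every a.e.-strongly measurable `F` (no integrability needed).
[cite: BalabanImbrieJaffe1988, §5.15 p.313] -/
theorem integral_extMeasure_axial {E : Type*} [NormedAddCommGroup E] [NormedSpace ℝ E] {F : Cfg P k → E}
    (hF : AEStronglyMeasurable F (D.extMeasure (axialLaw P k))) :
    ∫ q, F q ∂D.extMeasure (axialLaw P k) = ∫ r, F (cfg41 D r) ∂(prevMeasure P (k+1)).prod (volume : Measure D.EX) := by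
  rw [extMeasure_axial_eq_map_prevSucc D] at hF ⊢
  exact integral_map (measurable_cfg41 D).aemeasurable hF

end Form41

/-! ## §5 The RESULT in tested form -/

section Result

variable {ι Ω : Type*}

/-- **THE RESULT pp. 313–314 IN TESTED FORM, AT MEASURE LEVEL** (`ρ_{k+1}(v, ψ) = Σ_{{X_{ω′}}} ∫Π_{j=0}^{k} du^{(j)}|_{Λ^{(j)c*}_{10}} ρ′_{k+1}(v, ψ,
{X_{ω′}}, {u^{(j)}})` with (5.15.4) inside): for every bounded measurable test `g`,
`∫dvdψ ρ̃ g = Σ_{ω∈holes} Σ_{s∈fam ω} ∫dv′ ∫dψ ∫_{Π_{j≤k}𝒟u^{(j)} ⊗ dφ^{(k)}|_{Λ^{(k)c}_{10}(s)}} Y_s(cfg41_s(r), v′, ψ) g(v_{Λ_s}((cfg41_s r).1, v′), ψ)`: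
the outer sum over hole families, *"∫Π_{j=0}^{k} du^{(j)}"* r18's `prevMeasure P (k+1)` (interior bonds ignored by the integrand), `δ_{Ax}(u^{(k)})` the
axial gauge fixing inside `cfg41`, the exterior `φ^{(k)}`-integral of (5.15.4) explicit, `δ(v/Qu^{(k)})` the push-forward reading in the test function;
the bracket `Σ_{s∈fam ω} Y_s` is the transcribed, NOT factorized, `ρ′_{k+1}` (table `Result313`). [cite: BalabanImbrieJaffe1988, (5.15.4) p.314] -/
def IsR41T (holes : Finset Ω) (fam : Ω → Finset ι) (Λ : ι → Finset (PBond P (k+1))) (Qu : GaugeField P k U1 → GaugeField P (k+1) U1)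
    (D : ι → Interior P k) (Y : ι → Cfg P k → GaugeField P (k+1) U1 → HiggsField P (k+1) → ℂ)
    (ρL : GaugeField P (k+1) U1 → HiggsField P (k+1) → ℂ) : Prop :=
  ∀ g : GaugeField P (k+1) U1 × HiggsField P (k+1) → ℂ, Measurable g → (∃ C : ℝ, ∀ z, ‖g z‖ ≤ C) →
    ∫ v, ∫ ψ, ρL v ψ * g (v, ψ) ∂volume ∂fieldMeasure P (k+1) U1 =
      ∑ ω ∈ holes, ∑ s ∈ fam ω, ∫ v', ∫ ψ, ∫ r, Y s (cfg41 (D s) r) v' ψ * g (vCut Qu (Λ s) (cfg41 (D s) r).1 v', ψ)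
        ∂(prevMeasure P (k+1)).prod (volume : Measure (D s).EX) ∂volume ∂fieldMeasure P (k+1) U1

variable {holes : Finset Ω} {fam : Ω → Finset ι} {Λ : ι → Finset (PBond P (k+1))} {Qu : GaugeField P k U1 → GaugeField P (k+1) U1}
variable {Y : ι → Cfg P k → GaugeField P (k+1) U1 → HiggsField P (k+1) → ℂ} {ρL : GaugeField P (k+1) U1 → HiggsField P (k+1) → ℂ}

/-- **THE RESULT IN TESTED FORM, PROVED** from the hole-grouped final form over the exterior measures of (5.12.8) (one-bond laws of `𝒟u δ_{Ax}`):
the exterior integral of each term is rewritten over `Π_{j≤k}𝒟u^{(j)} ⊗ dφ^{(k)}|_{ext}` through the (4.1)-coordinates (`extMeasure_axial_eq_map_prevSucc`;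
jointly measurable brackets, measurable `Qu`). [cite: BalabanImbrieJaffe1988, (5.15.4) p.314] -/
theorem isR41T_of_isR313 (D : ι → Interior P k) (h : IsR313 holes fam Λ Qu (fun s => (D s).extMeasure (axialLaw P k)) Y ρL)
    (hQu : Measurable Qu)
    (hYm : ∀ ω ∈ holes, ∀ s ∈ fam ω, Measurable fun p : Cfg P k × (GaugeField P (k+1) U1 × HiggsField P (k+1)) => Y s p.1 p.2.1 p.2.2) :
    IsR41T holes fam Λ Qu D Y ρL := by
  intro g hg hb
  rw [h g hg hb]
  refine Finset.sum_congr rfl fun ω hω => Finset.sum_congr rfl fun s hs => ?_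
  refine integral_congr_ae (Filter.Eventually.of_forall fun v' => ?_)
  refine integral_congr_ae (Filter.Eventually.of_forall fun ψ => ?_)
  have hm : Measurable fun q : Cfg P k => Y s q v' ψ * g (vCut Qu (Λ s) q.1 v', ψ) := by
    refine ((hYm ω hω s hs).comp (measurable_id.prodMk (measurable_const.prodMk measurable_const))).mul (hg.comp ?_)
    refine (measurable_pi_iff.mpr fun c => ?_).prodMk measurable_const
    by_cases hc : c ∈ Λ s
    · simp only [vCut_apply, if_pos hc]; exact measurable_const
    · simp only [vCut_apply, if_neg hc]; exact (measurable_pi_apply c).comp (hQu.comp measurable_fst)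
  exact integral_extMeasure_axial (D s) hm.aestronglyMeasurable

/-- **ROW C2.Claim@313 — FROM THE FINAL FORM TO THE RESULT (tested form), PROVED**: a final-form display over the exterior measures of (5.12.8)
(laws of `𝒟u δ_{Ax}`) with jointly measurable brackets, grouped by the hole-family map `hole` (*"Let {X_{ω′}} be the components of Λ^{(k)c}_{13}"*),
IS the RESULT display in tested form with the fibres as the compatible data. [cite: BalabanImbrieJaffe1988, (5.15.4) p.314] -/
theorem result313_tested [DecidableEq Ω] {terms : Finset ι} (D : ι → Interior P k)
    (h : IsDF terms Λ Qu (fun s => (D s).extMeasure (axialLaw P k)) Y ρL) (hole : ι → Ω) (holes : Finset Ω)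
    (hh : ∀ s ∈ terms, hole s ∈ holes) (hQu : Measurable Qu)
    (hYm : ∀ s ∈ terms, Measurable fun p : Cfg P k × (GaugeField P (k+1) U1 × HiggsField P (k+1)) => Y s p.1 p.2.1 p.2.2) :
    IsR41T holes (fun ω => terms.filter fun s => hole s = ω) Λ Qu D Y ρL :=
  isR41T_of_isR313 D (isR313_of_isDF h hole holes hh) hQu fun _ _ s hs => hYm s (Finset.mem_filter.mp hs).1

/-- **THE PRINTED `ρ′_{k+1}` OF THE RESULT, AS TYPED SLOTS** (p. 313 last display; functions of the hole family and of `({u^{(j)}}_{j≤k}, v, ψ)` read on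
the configuration; the constructions are rows C2.Eq5.15.3 (scaling, `u_{k+1}`, `ℰ_{k+1}`), C2.Eq5.15.4 (`g_{k+1}`), C2.Eq4.1 and are NOT repeated).
[cite: BalabanImbrieJaffe1988, §5.15 p.313] -/
structure Result313 (P : Params) (k : ℕ) (Ω : Type*) where
  /-- `χ_{k+1,Λ^{(k)′}_0}` — the new small-field characteristic function ((4.5) at `k+1`). -/
  chi : Ω → Cfg P k → GaugeField P (k+1) U1 → HiggsField P (k+1) → ℝ
  /-- `Π_{ω′} g_{k+1}(X_{ω′})` — the hole functionals (5.15.4). -/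
  holeF : Ω → Cfg P k → GaugeField P (k+1) U1 → HiggsField P (k+1) → ℂ
  /-- `Π_{σ′} F_{k+1,loc}(X_{σ′})` — the next-step observables ((5.15.2), scaled). -/
  obs : Ω → Cfg P k → GaugeField P (k+1) U1 → HiggsField P (k+1) → ℂ
  /-- `Π_{j=0}^{k} [Z^{(j)}_{Λ^{(j)c*c}_{10}} Z^{(j)}_{Λ^{(j)}_{10}}(u_{k+1})]` — the normalization factors ((4.6), (4.9) scaled). -/
  zf : Ω → Cfg P k → GaugeField P (k+1) U1 → HiggsField P (k+1) → ℝ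
  /-- `⟨Λ^{(k)′**}_5 f^{(k+1)}, σ_{k+1,loc}Λ^{(k)′**}_5 f^{(k+1)}⟩`. -/
  quadF : Ω → Cfg P k → GaugeField P (k+1) U1 → HiggsField P (k+1) → ℝ
  /-- `⟨Λ^{(k)′}_8ψ, Δ_{k+1,loc}(u_{k+1})Λ^{(k)′}_8ψ⟩`. -/
  quadPsi : Ω → Cfg P k → GaugeField P (k+1) U1 → HiggsField P (k+1) → ℝ
  /-- `𝒫_{k+1,loc}(Λ^{(k)}_8)` — the scaled interaction. -/
  Ploc : Ω → Cfg P k → GaugeField P (k+1) U1 → HiggsField P (k+1) → ℝ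
  /-- `ℰ_{k+1}` — the `(k+1)`-th normalizing energy (5.15.3). -/
  calE : Ω → Cfg P k → GaugeField P (k+1) U1 → HiggsField P (k+1) → ℝ

/-- **`ρ′_{k+1}` transcribed**: `χ_{k+1,Λ₀′} · Πg_{k+1} · ΠF_{k+1,loc} · Π[ZZ(u_{k+1})] · exp[−½⟨f,σf⟩ − ½⟨ψ,Δψ⟩ − 𝒫_{k+1,loc} − ℰ_{k+1}]` (printed order,
printed `½`'s). [cite: BalabanImbrieJaffe1988, §5.15 p.313] -/
def rhoPrime313 (R : Result313 P k Ω) (ω : Ω) (q : Cfg P k) (v : GaugeField P (k+1) U1) (ψ : HiggsField P (k+1)) : ℂ :=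
  (R.chi ω q v ψ : ℂ) * R.holeF ω q v ψ * R.obs ω q v ψ * (R.zf ω q v ψ : ℂ) *
    (Real.exp (-(R.quadF ω q v ψ / 2 + R.quadPsi ω q v ψ / 2 + R.Ploc ω q v ψ + R.calE ω q v ψ)) : ℂ)

/-- kernel: a term of the transcribed `ρ′_{k+1}` vanishes off the new small-field characteristic function. [cite: BalabanImbrieJaffe1988, §5.15 p.313] -/
theorem rhoPrime313_eq_zero_of_chi (R : Result313 P k Ω) {ω : Ω} {q : Cfg P k} {v : GaugeField P (k+1) U1} {ψ : HiggsField P (k+1)}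
    (h : R.chi ω q v ψ = 0) : rhoPrime313 R ω q v ψ = 0 := by
  simp only [rhoPrime313, h, Complex.ofReal_zero, zero_mul]

/-- **THE PASSAGE (5.9.6) ⇒ RESULT pp. 313–314 AT MEASURE LEVEL, IN ONE STATEMENT (PROVED modulo the displayed pointwise identities).**  From LINE 1
OF (5.9.6) over `∫𝒟u δ_{Ax}` (gen 9's `BIJ88Eq596Frame.eq596_frame`): (i) the expansions of Sect. 5.11 / p. 300 (`hJ`, jointly integrable pieces
`hJ'i`); (ii) the conditioning of Sect. 5.12 (factorization `hfac` with interior sets `D`, locality `hv`, weight data); (iii) the cluster expansion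
and second Mayer expansion, Sects. 5.13–5.15, as the identity `hC` for the VALUE of the conditional interior integral (rows C2.Eq5.13.x–5.15.2) with
jointly integrable / measurable products; (iv) the hole-family map (*"the components of Λ^{(k)c}_{13}"*).  CONCLUSION: the RESULT display in tested
form over r18's `Π_{j≤k}𝒟u^{(j)}` ⊗ `dφ^{(k)}|_{ext}` (`IsR41T`). [cite: BalabanImbrieJaffe1988, (5.15.4) p.314] -/
theorem result313_of_isDT {ι' ι'' : Type*} [DecidableEq ι] [DecidableEq ι'] [DecidableEq Ω] {terms : Finset ι}
    {J : ι → Prev P k → GaugeField P k U1 → GaugeField P (k+1) U1 → HiggsField P k → HiggsField P (k+1) → ℂ}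
    (h : IsDT (axialMeasure P k U1) terms Λ Qu J ρL) (hQu : Measurable Qu)
    (terms' : Finset ι') (π : ι' → ι) (hπ : ∀ s ∈ terms', π s ∈ terms)
    (J' : ι' → Prev P k → GaugeField P k U1 → GaugeField P (k+1) U1 → HiggsField P k → HiggsField P (k+1) → ℂ)
    (hJ : ∀ t ∈ terms, ∀ prev u v φ ψ, J t prev u v φ ψ = ∑ s ∈ terms'.filter (fun s => π s = t), J' s prev u v φ ψ)
    (hJ'i : ∀ s ∈ terms', Integrable (termIntegrand (Λ ∘ π) Qu J' s) (termMeasure (Measure.pi (axialLaw P k))))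
    (D : ι' → Interior P k) (Xf B : ι' → Cfg P k → GaugeField P (k+1) U1 → HiggsField P (k+1) → ℂ)
    (W : ι' → Cfg P k → GaugeField P (k+1) U1 → HiggsField P (k+1) → ℝ)
    (hv : ∀ s ∈ terms', ∀ (q : Cfg P k) (v' : GaugeField P (k+1) U1), vCut Qu (Λ (π s)) ((D s).freeze q).1 v' = vCut Qu (Λ (π s)) q.1 v')
    (hfac : ∀ s ∈ terms', ∀ (q : Cfg P k) (v' : GaugeField P (k+1) U1) (ψ : HiggsField P (k+1)),
      J' s q.2.1 (uCut Qu (Λ (π s)) q.1) (vCut Qu (Λ (π s)) q.1 v') q.2.2 ψ = Xf s ((D s).freeze q) v' ψ * (W s q v' ψ : ℂ) * B s q v' ψ)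
    (hWm : ∀ s ∈ terms', Measurable fun p : Cfg P k × (GaugeField P (k+1) U1 × HiggsField P (k+1)) => W s p.1 p.2.1 p.2.2)
    (hW0 : ∀ s ∈ terms', ∀ q v' ψ, 0 < W s q v' ψ)
    (hWi : ∀ s ∈ terms', ∀ (e : (D s).Ext) (v' : GaugeField P (k+1) U1) (ψ : HiggsField P (k+1)),
      Integrable (fun i => W s ((D s).glue e i) v' ψ) ((D s).μInt (axialLaw P k)))
    (terms'' : Finset ι'') (π' : ι'' → ι') (hπ' : ∀ c ∈ terms'', π' c ∈ terms')
    (C : ι'' → Cfg P k → GaugeField P (k+1) U1 → HiggsField P (k+1) → ℂ)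
    (hC : ∀ s ∈ terms', ∀ (q : Cfg P k) (v' : GaugeField P (k+1) U1) (ψ : HiggsField P (k+1)),
      ∫ q', B s q' v' ψ ∂condW (D s) (axialLaw P k) (fun q' => W s q' v' ψ) q = ∑ c ∈ terms''.filter (fun c => π' c = s), C c q v' ψ)
    (hi : ∀ c ∈ terms'', Integrable (fun r : GaugeField P (k+1) U1 × (HiggsField P (k+1) × Cfg P k) =>
      Xf (π' c) r.2.2 r.1 r.2.1 * (normW (D (π' c)) (axialLaw P k) (fun q' => W (π' c) q' r.1 r.2.1) r.2.2 : ℂ) * C c r.2.2 r.1 r.2.1)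
      (termMeasure313 ((D (π' c)).extMeasure (axialLaw P k))))
    (hYm : ∀ c ∈ terms'', Measurable fun p : Cfg P k × (GaugeField P (k+1) U1 × HiggsField P (k+1)) =>
      Xf (π' c) p.1 p.2.1 p.2.2 * (normW (D (π' c)) (axialLaw P k) (fun q' => W (π' c) q' p.2.1 p.2.2) p.1 : ℂ) * C c p.1 p.2.1 p.2.2)
    (hole : ι'' → Ω) (holes : Finset Ω) (hh : ∀ c ∈ terms'', hole c ∈ holes) :
    IsR41T holes (fun ω => terms''.filter fun c => hole c = ω) ((Λ ∘ π) ∘ π') Qu (D ∘ π')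
      (fun c q v' ψ => Xf (π' c) q v' ψ * (normW (D (π' c)) (axialLaw P k) (fun q' => W (π' c) q' v' ψ) q : ℂ) * C c q v' ψ) ρL := by
  have h1 := isDC_of_isDT_expand (isDT_axial_iff.mp h) hQu terms' π hπ J' hJ hJ'i D Xf B W hv hfac hWm hW0 hWi
  have h2 := isDF_of_isDC_insert h1 terms'' π' hπ' C hC hQu hi
  exact result313_tested (D ∘ π') h2 hole holes hh hQu hYm

end Result

/-! ## §7 (v1.1) The RESULT display as ONE predicate on the table -/

section ResultPredicate

variable {ι Ω : Type*}

/-- **THE RESULT pp. 313–314 AS ONE PREDICATE** (v1.1; the owner's nicety, r16 2026-08-22T03:22:11Z): *"The result can be written as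
ρ_{k+1}(v, ψ) = Σ_ω Σ_{X_ω} ∫Π_{j=0}^{k}du^{(j)}|_{X_ω^c} χ_{k+1,Λ^{(k)′}_0} Π_{ω′}g_{k+1}(X_{ω′}) Π_{σ′}F_{k+1,loc}(X_{σ′}) Π_{j=0}^{k}[Z^{(j)}Z^{(j)}(u_{k+1})]
exp[−½⟨Λ₅f, σf⟩ − ½⟨Λ₈′ψ, Δψ⟩ − 𝒫_{k+1,loc} − ℰ_{k+1}]"* — the tested (4.1)-type display `IsR41T` whose integrand is the TRANSCRIBED `ρ′_{k+1}` of
the table `Result313` (`rhoPrime313`), read at the hole `hole s` of each term: ONE declaration whose statement is the printed display.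
[cite: BalabanImbrieJaffe1988, (5.15.4) p.314] -/
def IsResult313 (R : Result313 P k Ω) (holes : Finset Ω) (fam : Ω → Finset ι) (Λ : ι → Finset (PBond P (k+1)))
    (Qu : GaugeField P k U1 → GaugeField P (k+1) U1) (D : ι → Interior P k) (hole : ι → Ω)
    (ρL : GaugeField P (k+1) U1 → HiggsField P (k+1) → ℂ) : Prop :=
  IsR41T holes fam Λ Qu D (fun s => rhoPrime313 R (hole s)) ρL

/-- kernel: the RESULT predicate is the tested (4.1)-type display with the transcribed integrand (definitional). [cite: BalabanImbrieJaffe1988, (5.15.4) p.314] -/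
theorem isResult313_iff (R : Result313 P k Ω) (holes : Finset Ω) (fam : Ω → Finset ι) (Λ : ι → Finset (PBond P (k+1)))
    (Qu : GaugeField P k U1 → GaugeField P (k+1) U1) (D : ι → Interior P k) (hole : ι → Ω)
    (ρL : GaugeField P (k+1) U1 → HiggsField P (k+1) → ℂ) :
    IsResult313 R holes fam Λ Qu D hole ρL ↔ IsR41T holes fam Λ Qu D (fun s => rhoPrime313 R (hole s)) ρL :=
  Iff.rfl

/-- **RESULT from its tested form with a transcribed integrand**: if the tested display holds with an integrand that IS, term by term, the
transcribed `ρ′_{k+1}` at the term's hole, the RESULT predicate holds. [cite: BalabanImbrieJaffe1988, (5.15.4) p.314] -/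
theorem isResult313_of_isR41T (R : Result313 P k Ω) {holes : Finset Ω} {fam : Ω → Finset ι} {Λ : ι → Finset (PBond P (k+1))}
    {Qu : GaugeField P k U1 → GaugeField P (k+1) U1} {D : ι → Interior P k} (hole : ι → Ω)
    {Y : ι → Cfg P k → GaugeField P (k+1) U1 → HiggsField P (k+1) → ℂ} {ρL : GaugeField P (k+1) U1 → HiggsField P (k+1) → ℂ}
    (h : IsR41T holes fam Λ Qu D Y ρL) (hY : ∀ ω ∈ holes, ∀ s ∈ fam ω, ∀ q v' ψ, Y s q v' ψ = rhoPrime313 R (hole s) q v' ψ) :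
    IsResult313 R holes fam Λ Qu D hole ρL := by
  intro g hg hb
  rw [h g hg hb]
  refine Finset.sum_congr rfl fun ω hω => Finset.sum_congr rfl fun s hs => ?_
  simp only [hY ω hω s hs]

end ResultPredicate

end

end Literature.MathematicalPhysics.QuantumFieldTheory.BalabanImbrieJaffe1984to88.BIJ88FinalForm313
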